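import Literature.MathematicalPhysics.QuantumManyBody.NeumannBoxParseval
import HarnessLib

/-!
# Parseval and the Dirichlet form for the product SINE modes of a cube; the free Dirichlet gap

Topic `Literature/MathematicalPhysics/QuantumManyBody`, grouping namespace `DirichletBox`
(companion of `NeumannCosineParseval.lean` / `NeumannBoxParseval.lean`, which treat the Neumann
COSINE modes). For the FREE Bose (or any) gas in the box `(0,ℓ)^d` with DIRICHLET conditions the
natural one-dimensional factors are the sine modes `s_n(t) = (2/ℓ)^{1/2} sin(nπt/ℓ)`, `n ≥ 1`
[LSSY2005, Ch. 2: "the kinetic energy of a single particle in the ground state in the box is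
`3π²/ℓ²`" (Dirichlet), first excited level `6π²/ℓ²`]. We prove, for continuous (resp. `C¹`)
complex functions on the closed cube `[0,ℓ]^d ⊂ ℝ^d` (coordinates `Fin d → ℝ`):

* `tsum_enorm_sq_sinCoef` — **Parseval**: `∑_{k ∈ ℕ^d} |∫_{[0,ℓ]^d} S_k g|² = ∫_{[0,ℓ]^d} |g|²`
  for the product modes `S_k(y) = ∏ⱼ s_{kⱼ}(yⱼ)` (indices with a zero entry contribute `0`);
* `tsum_sum_waveNumber_sq_mul_enorm_sq_sinCoef` — **the Dirichlet form is diagonal**: for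
  `g ∈ C¹(ℝ^d)` vanishing on the faces of the cube,
  `∑_k (∑ᵢ (kᵢπ/ℓ)²) |∫ S_k g|² = ∫_{[0,ℓ]^d} ∑ᵢ |∂ᵢ g|²`;
* (companion file `FreeDirichletGap.lean`) the free Dirichlet gap
  `((d+3)π²/ℓ²) ∫|g|² ≤ ∫ ∑ᵢ|∂ᵢg|² + (3π²/ℓ²) |∫ S_𝟙 g|²` and its `N`-particle box form.

Method: exactly the slicing engine of `NeumannBoxParseval.lean` (slice `[0,ℓ]^{d+1}` at a
coordinate with Mathlib's measure-preserving `piFinSuccAbove`, a one-dimensional identity on each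
fibre, Tonelli, induction on `d`), fed with the one-dimensional SINE Parseval
(`NeumannBox.hasSum_sq_integral_sin_mul`, valid for every continuous `f`) and the one-dimensional
Dirichlet form identity `∫₀^ℓ|f'|² = ∑ₙ (nπ/ℓ)²(2/ℓ)|∫₀^ℓ sin(nπt/ℓ) f|²` for `f ∈ C¹[0,ℓ]` with
`f(0) = f(ℓ) = 0` (`hasSum_sq_norm_deriv_dirichlet`: cosine Parseval for `f'` and an integration by
parts whose boundary terms are `f(ℓ)cos(nπ) − f(0) = 0`). All sums in `ℝ≥0∞`. NO definitions: the
modes are written out as `Real.sqrt (2 / ℓ) * Real.sin (waveNumber ℓ n * t)` with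
`NeumannBox.waveNumber ℓ n = nπ/ℓ`.

## References

* [LSSY2005] E. H. Lieb, R. Seiringer, J. P. Solovej, J. Yngvason, *The Mathematics of the Bose Gas
  and its Condensation*, Birkhäuser 2005: Ch. 2, (2.3) and after (2.50).
-/

noncomputable section

open Real intervalIntegral MeasureTheory Set Filter Topology Complex
open scoped ENNReal NNReal

namespace Literature.MathematicalPhysics.QuantumManyBody.DirichletBox

open Literature.MathematicalPhysics.QuantumManyBody.NeumannBox

/-! ### One-dimensional identities -/

/-- `‖∫₀^ℓ s_n f‖² = (2/ℓ)‖∫₀^ℓ sin(nπt/ℓ) f‖²` for the normalised sine mode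
`s_n = (2/ℓ)^{1/2} sin(nπ·/ℓ)` (`ℓ > 0`). [folklore] -/
theorem norm_sq_integral_sinMode_mul {ℓ : ℝ} (hℓ : 0 < ℓ) (n : ℕ) (f : ℝ → ℂ) :
    ‖∫ t in (0 : ℝ)..ℓ, ((Real.sqrt (2 / ℓ) * Real.sin (waveNumber ℓ n * t) : ℝ) : ℂ) * f t‖ ^ 2 =
      2 / ℓ * ‖∫ t in (0 : ℝ)..ℓ, (Real.sin (n * π / ℓ * t) : ℂ) * f t‖ ^ 2 := by
  have h1 : (fun t : ℝ => ((Real.sqrt (2 / ℓ) * Real.sin (waveNumber ℓ n * t) : ℝ) : ℂ) * f t) =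
      fun t => ((Real.sqrt (2 / ℓ) : ℝ) : ℂ) * ((Real.sin (n * π / ℓ * t) : ℂ) * f t) := by
    funext t; simp only [waveNumber]; push_cast; ring
  rw [h1, intervalIntegral.integral_const_mul, norm_mul, mul_pow, Complex.norm_real,
    Real.norm_eq_abs, sq_abs, Real.sq_sqrt (by positivity)]

/-- **Sine Parseval in the normalised modes, `ℝ≥0∞` form**: for continuous `f : ℝ → ℂ` and
`ℓ > 0`, `∑ₙ ‖∫₀^ℓ s_n f‖² = ∫₀^ℓ ‖f‖²` (the `n = 0` term is `0`). [folklore] -/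
theorem tsum_enorm_sq_integral_sinMode_mul {ℓ : ℝ} (hℓ : 0 < ℓ) {f : ℝ → ℂ} (hf : Continuous f) :
    ∑' n : ℕ, ‖∫ t in (0 : ℝ)..ℓ,
        ((Real.sqrt (2 / ℓ) * Real.sin (waveNumber ℓ n * t) : ℝ) : ℂ) * f t‖ₑ ^ 2 =
      ∫⁻ t in Ioc 0 ℓ, ‖f t‖ₑ ^ 2 := by
  rw [← ofReal_intervalIntegral_norm_sq hℓ.le hf,
    ← tsum_ofReal_eq_of_hasSum (fun n => by positivity) (hasSum_sq_integral_sin_mul hℓ hf)]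
  congr 1; funext n
  rw [← ofReal_norm, ← ENNReal.ofReal_pow (norm_nonneg _), norm_sq_integral_sinMode_mul hℓ]

/-- **Integration by parts with Dirichlet boundary values**: for `f ∈ C¹[0,ℓ]` with
`f(0) = f(ℓ) = 0` and `n ≥ 0`, `∫₀^ℓ cos(nπt/ℓ) f'(t) dt = (nπ/ℓ) ∫₀^ℓ sin(nπt/ℓ) f(t) dt`
(the boundary terms `cos(nπ) f(ℓ) − f(0)` vanish). [folklore] -/
theorem integral_cos_mul_deriv_of_dirichlet {ℓ : ℝ} (n : ℕ) {f f' : ℝ → ℂ}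
    (hf : ∀ x ∈ uIcc (0 : ℝ) ℓ, HasDerivAt f (f' x) x) (hf' : Continuous f')
    (h0 : f 0 = 0) (hℓ0 : f ℓ = 0) :
    ∫ x in (0 : ℝ)..ℓ, (Real.cos (n * π / ℓ * x) : ℂ) * f' x =
      ((n * π / ℓ : ℝ) : ℂ) * ∫ x in (0 : ℝ)..ℓ, (Real.sin (n * π / ℓ * x) : ℂ) * f x := by
  set k : ℝ := n * π / ℓ with hk
  have hu : ∀ x ∈ uIcc (0 : ℝ) ℓ, HasDerivAt (fun y : ℝ => (Real.cos (k * y) : ℂ))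
      (((-(k * Real.sin (k * x)) : ℝ) : ℂ)) x := by
    intro x _
    have h1 : HasDerivAt (fun y : ℝ => k * y) k x := by
      simpa using (hasDerivAt_id x).const_mul k
    have h2 : HasDerivAt (fun y : ℝ => Real.cos (k * y)) (-Real.sin (k * x) * k) x := h1.cos
    refine h2.ofReal_comp.congr_deriv ?_
    push_cast; ring
  have hu'int : IntervalIntegrable (fun x => (((-(k * Real.sin (k * x))) : ℝ) : ℂ)) volume 0 ℓ :=
    (Continuous.intervalIntegrable (by fun_prop) _ _)
  have hv'int : IntervalIntegrable f' volume 0 ℓ := hf'.intervalIntegrable _ _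
  rw [intervalIntegral.integral_mul_deriv_eq_deriv_mul hu hf hu'int hv'int, h0, hℓ0]
  simp only [mul_zero, sub_zero, zero_sub]
  rw [← intervalIntegral.integral_neg, ← intervalIntegral.integral_const_mul]
  congr 1
  funext x
  push_cast
  ring

/-- **The Dirichlet form `∫₀^ℓ |f'|²` is diagonal in the sine modes, with eigenvalues `(nπ/ℓ)²`**:
for `f ∈ C¹[0,ℓ]` with `f(0) = f(ℓ) = 0`,
`∑ₙ (2/ℓ)(nπ/ℓ)² |∫₀^ℓ sin(nπt/ℓ) f|² = ∫₀^ℓ |f'|²` (cosine Parseval for `f'`, whose constant mode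
carries `|f(ℓ) − f(0)|² = 0`, and `integral_cos_mul_deriv_of_dirichlet`).
[cite: LSSY2005, Ch. 2, after (2.50)] -/
theorem hasSum_sq_norm_deriv_dirichlet {ℓ : ℝ} (hℓ : 0 < ℓ) {f f' : ℝ → ℂ}
    (hf : ∀ x ∈ uIcc (0 : ℝ) ℓ, HasDerivAt f (f' x) x) (hf' : Continuous f')
    (h0 : f 0 = 0) (hℓ0 : f ℓ = 0) :
    HasSum (fun n : ℕ => 2 / ℓ * (n * π / ℓ) ^ 2 *
        ‖∫ x in (0 : ℝ)..ℓ, (Real.sin (n * π / ℓ * x) : ℂ) * f x‖ ^ 2)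
      (∫ x in (0 : ℝ)..ℓ, ‖f' x‖ ^ 2) := by
  have h := hasSum_sq_integral_cos_mul hℓ hf'
  have hfun : (fun n : ℕ => (if n = 0 then 1 else 2) / ℓ *
      ‖∫ x in (0 : ℝ)..ℓ, (Real.cos (n * π / ℓ * x) : ℂ) * f' x‖ ^ 2) =
      fun n : ℕ => 2 / ℓ * (n * π / ℓ) ^ 2 *
        ‖∫ x in (0 : ℝ)..ℓ, (Real.sin (n * π / ℓ * x) : ℂ) * f x‖ ^ 2 := by
    funext n
    rw [integral_cos_mul_deriv_of_dirichlet n hf hf' h0 hℓ0, norm_mul, Complex.norm_real,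
      Real.norm_eq_abs, mul_pow, sq_abs]
    rcases eq_or_ne n 0 with rfl | hn
    · simp
    · rw [if_neg hn]; ring
  rwa [hfun] at h

/-- **The Dirichlet form in the normalised sine modes, `ℝ≥0∞` form**: for `f ∈ C¹[0,ℓ]` with
`f(0) = f(ℓ) = 0`, `∑ₙ (nπ/ℓ)² ‖∫₀^ℓ s_n f‖² = ∫₀^ℓ ‖f'‖²`. [cite: LSSY2005, Ch. 2, after (2.50)] -/
theorem tsum_waveNumber_sq_mul_enorm_sq_integral_sinMode_mul {ℓ : ℝ} (hℓ : 0 < ℓ) {f f' : ℝ → ℂ}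
    (hf : ∀ x ∈ uIcc (0 : ℝ) ℓ, HasDerivAt f (f' x) x) (hf' : Continuous f')
    (h0 : f 0 = 0) (hℓ0 : f ℓ = 0) :
    ∑' n : ℕ, ENNReal.ofReal (waveNumber ℓ n ^ 2) * ‖∫ t in (0 : ℝ)..ℓ,
        ((Real.sqrt (2 / ℓ) * Real.sin (waveNumber ℓ n * t) : ℝ) : ℂ) * f t‖ₑ ^ 2 =
      ∫⁻ t in Ioc 0 ℓ, ‖f' t‖ₑ ^ 2 := by
  rw [← ofReal_intervalIntegral_norm_sq hℓ.le hf',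
    ← tsum_ofReal_eq_of_hasSum (fun n => by positivity)
      (hasSum_sq_norm_deriv_dirichlet hℓ hf hf' h0 hℓ0)]
  congr 1; funext n
  rw [← ofReal_norm, ← ENNReal.ofReal_pow (norm_nonneg _), ← ENNReal.ofReal_mul (sq_nonneg _),
    norm_sq_integral_sinMode_mul hℓ, waveNumber]
  ring_nf

/-! ### The cube `[0,ℓ]^d` sliced at a coordinate: sine product modes -/

variable {d : ℕ} {ℓ : ℝ}

/-- The product sine mode with multi-index `insertNth i n k'` splits off its `i`-th factor.
[folklore] -/
theorem prod_sinMode_insertNth (i : Fin (d + 1)) (n : ℕ) (k' : Fin d → ℕ) (y : Fin (d + 1) → ℝ) :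
    (∏ j, Real.sqrt (2 / ℓ) * Real.sin (waveNumber ℓ ((i.insertNth n k' : Fin (d + 1) → ℕ) j) * y j)) =
      (Real.sqrt (2 / ℓ) * Real.sin (waveNumber ℓ n * y i)) *
        ∏ j, Real.sqrt (2 / ℓ) * Real.sin (waveNumber ℓ (k' j) * y (i.succAbove j)) := by
  rw [Fin.prod_univ_succAbove _ i]
  simp only [Fin.insertNth_apply_same, Fin.insertNth_apply_succAbove]

/-- **The partial sine coefficient is continuous**: for continuous `g` on `ℝ^{d+1}`,
`y' ↦ ∫₀^ℓ s_n(t) g(y' with t inserted at i) dt` is continuous on `ℝ^d`. [folklore] -/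
theorem continuous_partialSinCoeff (i : Fin (d + 1)) {g : (Fin (d + 1) → ℝ) → ℂ}
    (hg : Continuous g) (n : ℕ) :
    Continuous fun y' : Fin d → ℝ =>
      ∫ t in (0 : ℝ)..ℓ, ((Real.sqrt (2 / ℓ) * Real.sin (waveNumber ℓ n * t) : ℝ) : ℂ) *
        g (i.insertNth t y') := by
  have : Continuous (Function.uncurry fun (y' : Fin d → ℝ) (t : ℝ) =>
      ((Real.sqrt (2 / ℓ) * Real.sin (waveNumber ℓ n * t) : ℝ) : ℂ) * g (i.insertNth t y')) := by
    apply Continuous.mul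
    · exact continuous_ofReal.comp ((by fun_prop : Continuous fun t : ℝ =>
        Real.sqrt (2 / ℓ) * Real.sin (waveNumber ℓ n * t)).comp continuous_snd)
    · exact hg.comp (Continuous.finInsertNth i continuous_snd continuous_fst)
  exact intervalIntegral.continuous_parametric_intervalIntegral_of_continuous' this 0 ℓ

/-- **Fubini for the sine coefficients**: the coefficient of `g` on `[0,ℓ]^{d+1}` against the
product mode `S_{insertNth i n k'}` is the coefficient, on `[0,ℓ]^d` against `S_{k'}`, of the
partial coefficient `y' ↦ ∫₀^ℓ s_n(t) g(…t…) dt`. [folklore] -/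
theorem integral_Icc_prodSinMode_insertNth_mul (hℓ : 0 < ℓ) (i : Fin (d + 1))
    {g : (Fin (d + 1) → ℝ) → ℂ} (hg : Continuous g) (n : ℕ) (k' : Fin d → ℕ) :
    ∫ y in Icc (0 : Fin (d + 1) → ℝ) (fun _ => ℓ),
        ((∏ j, Real.sqrt (2 / ℓ) *
          Real.sin (waveNumber ℓ ((i.insertNth n k' : Fin (d + 1) → ℕ) j) * y j) : ℝ) : ℂ) * g y =
      ∫ y' in Icc (0 : Fin d → ℝ) (fun _ => ℓ),
        ((∏ j, Real.sqrt (2 / ℓ) * Real.sin (waveNumber ℓ (k' j) * y' j) : ℝ) : ℂ) *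
          ∫ t in (0 : ℝ)..ℓ, ((Real.sqrt (2 / ℓ) * Real.sin (waveNumber ℓ n * t) : ℝ) : ℂ) *
            g (i.insertNth t y') := by
  set e := MeasurableEquiv.piFinSuccAbove (fun _ : Fin (d + 1) => ℝ) i with he
  have hmp : MeasurePreserving e volume (volume.prod volume) :=
    volume_preserving_piFinSuccAbove _ i
  set F : ℝ × (Fin d → ℝ) → ℂ := fun z =>
    (((Real.sqrt (2 / ℓ) * Real.sin (waveNumber ℓ n * z.1)) *
        ∏ j, Real.sqrt (2 / ℓ) * Real.sin (waveNumber ℓ (k' j) * z.2 j) : ℝ) : ℂ) *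
      g (i.insertNth z.1 z.2) with hF
  have hFc : Continuous F := by
    apply Continuous.mul
    · refine continuous_ofReal.comp ?_
      refine ((by fun_prop : Continuous fun t : ℝ =>
        Real.sqrt (2 / ℓ) * Real.sin (waveNumber ℓ n * t)).comp continuous_fst).mul ?_
      exact continuous_finsetProd _ fun j _ =>
        (by fun_prop : Continuous fun t : ℝ =>
          Real.sqrt (2 / ℓ) * Real.sin (waveNumber ℓ (k' j) * t)).comp
          ((continuous_apply j).comp continuous_snd)
    · exact hg.comp (Continuous.finInsertNth i continuous_fst continuous_snd)
  have hintegrand : ∀ y : Fin (d + 1) → ℝ,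
      ((∏ j, Real.sqrt (2 / ℓ) *
          Real.sin (waveNumber ℓ ((i.insertNth n k' : Fin (d + 1) → ℕ) j) * y j) : ℝ) : ℂ) * g y =
        F (e y) := by
    intro y
    simp only [hF, he, MeasurableEquiv.piFinSuccAbove_apply, Fin.insertNthEquiv_symm_apply,
      Fin.insertNth_self_removeNth, Fin.removeNth_apply, prod_sinMode_insertNth]
  simp_rw [hintegrand]
  rw [Icc_eq_preimage_piFinSuccAbove i ℓ, hmp.setIntegral_preimage_emb e.measurableEmbedding,
    ← Measure.prod_restrict]
  have hint : Integrable F ((volume.restrict (Icc (0 : ℝ) ℓ)).prod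
      (volume.restrict (Icc (0 : Fin d → ℝ) fun _ => ℓ))) := by
    rw [Measure.prod_restrict]
    exact (hFc.continuousOn.integrableOn_compact (isCompact_Icc.prod isCompact_Icc))
  rw [integral_prod_symm F hint]
  refine setIntegral_congr_fun measurableSet_Icc fun y' _ => ?_
  have h1 : ∀ t : ℝ, F (t, y') =
      ((∏ j, Real.sqrt (2 / ℓ) * Real.sin (waveNumber ℓ (k' j) * y' j) : ℝ) : ℂ) *
        (((Real.sqrt (2 / ℓ) * Real.sin (waveNumber ℓ n * t) : ℝ) : ℂ) * g (i.insertNth t y')) := by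
    intro t; simp only [hF]; push_cast; ring
  simp_rw [h1]
  rw [MeasureTheory.integral_const_mul, integral_Icc_eq_integral_Ioc,
    ← intervalIntegral.integral_of_le hℓ.le]

/-- **The slicing engine (sine modes).** Suppose Parseval holds for the product sine modes on
`[0,ℓ]^d` (hypothesis `hA`, for all continuous functions). Let `g` be continuous on `ℝ^{d+1}`, `i`
a coordinate, and suppose on every fibre in the direction `i` a one-dimensional identity
`∑ₙ wₙ ‖∫₀^ℓ s_n(t) g(…t…) dt‖² = ∫₀^ℓ h(…t…) dt` holds. Then
`∑_k w_{kᵢ} ‖⟨S_k, g⟩‖² = ∫_{[0,ℓ]^{d+1}} h`. [folklore] -/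
theorem tsum_mul_enorm_sq_sinCoef_eq_of_fibre (hℓ : 0 < ℓ)
    (hA : ∀ {g : (Fin d → ℝ) → ℂ}, Continuous g →
      ∑' k : Fin d → ℕ, ‖∫ y in Icc (0 : Fin d → ℝ) (fun _ => ℓ),
          ((∏ j, Real.sqrt (2 / ℓ) * Real.sin (waveNumber ℓ (k j) * y j) : ℝ) : ℂ) * g y‖ₑ ^ 2 =
        ∫⁻ y in Icc (0 : Fin d → ℝ) (fun _ => ℓ), ‖g y‖ₑ ^ 2)
    (i : Fin (d + 1)) {g : (Fin (d + 1) → ℝ) → ℂ} (hg : Continuous g) (w : ℕ → ℝ≥0∞)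
    {h : (Fin (d + 1) → ℝ) → ℝ≥0∞} (hh : Measurable h)
    (hfib : ∀ y' : Fin d → ℝ,
      ∑' n : ℕ, w n * ‖∫ t in (0 : ℝ)..ℓ,
          ((Real.sqrt (2 / ℓ) * Real.sin (waveNumber ℓ n * t) : ℝ) : ℂ) * g (i.insertNth t y')‖ₑ ^ 2 =
        ∫⁻ t in Ioc 0 ℓ, h (i.insertNth t y')) :
    ∑' k : Fin (d + 1) → ℕ, w (k i) * ‖∫ y in Icc (0 : Fin (d + 1) → ℝ) (fun _ => ℓ),
        ((∏ j, Real.sqrt (2 / ℓ) * Real.sin (waveNumber ℓ (k j) * y j) : ℝ) : ℂ) * g y‖ₑ ^ 2 =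
      ∫⁻ y in Icc (0 : Fin (d + 1) → ℝ) (fun _ => ℓ), h y := by
  set e := MeasurableEquiv.piFinSuccAbove (fun _ : Fin (d + 1) => ℝ) i with he
  have hmp : MeasurePreserving e volume (volume.prod volume) :=
    volume_preserving_piFinSuccAbove _ i
  set G : ℕ → (Fin d → ℝ) → ℂ := fun n y' =>
    ∫ t in (0 : ℝ)..ℓ, ((Real.sqrt (2 / ℓ) * Real.sin (waveNumber ℓ n * t) : ℝ) : ℂ) *
      g (i.insertNth t y') with hG
  have hGc : ∀ n, Continuous (G n) := fun n => continuous_partialSinCoeff i hg n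
  -- the right-hand side, sliced
  have hR : ∫⁻ y in Icc (0 : Fin (d + 1) → ℝ) (fun _ => ℓ), h y =
      ∫⁻ y' in Icc (0 : Fin d → ℝ) (fun _ => ℓ), ∫⁻ t in Ioc 0 ℓ, h (i.insertNth t y') := by
    set H : ℝ × (Fin d → ℝ) → ℝ≥0∞ := fun z => h (e.symm z) with hH
    have h1 : ∫⁻ y in Icc (0 : Fin (d + 1) → ℝ) (fun _ => ℓ), h y =
        ∫⁻ y in e ⁻¹' (Icc (0 : ℝ) ℓ ×ˢ Icc (0 : Fin d → ℝ) fun _ => ℓ), H (e y) := by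
      rw [← Icc_eq_preimage_piFinSuccAbove i ℓ]
      simp only [hH, MeasurableEquiv.symm_apply_apply]
    rw [h1, hmp.setLIntegral_comp_preimage_emb e.measurableEmbedding H, ← Measure.prod_restrict,
      lintegral_prod_symm H (show Measurable H from hh.comp e.symm.measurable).aemeasurable]
    refine setLIntegral_congr_fun measurableSet_Icc fun y' _ => ?_
    rw [Measure.restrict_congr_set Ioc_ae_eq_Icc]
    rfl
  -- Tonelli for the sum over `n`, then the `d`-dimensional Parseval for each partial coefficient
  have hR2 : ∫⁻ y' in Icc (0 : Fin d → ℝ) (fun _ => ℓ), ∫⁻ t in Ioc 0 ℓ, h (i.insertNth t y') =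
      ∑' n : ℕ, w n * ∑' k' : Fin d → ℕ, ‖∫ y' in Icc (0 : Fin d → ℝ) (fun _ => ℓ),
        ((∏ j, Real.sqrt (2 / ℓ) * Real.sin (waveNumber ℓ (k' j) * y' j) : ℝ) : ℂ) *
          G n y'‖ₑ ^ 2 := by
    simp_rw [← hfib]
    rw [lintegral_tsum fun n => ?_]
    · congr 1; funext n
      rw [lintegral_const_mul _ ((hGc n).measurable.enorm.pow_const 2), hA (hGc n)]
    · exact (((hGc n).measurable.enorm.pow_const 2).const_mul _).aemeasurable
  -- the left-hand side, re-indexed by `k = insertNth i n k'`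
  have hL : ∑' k : Fin (d + 1) → ℕ, w (k i) * ‖∫ y in Icc (0 : Fin (d + 1) → ℝ) (fun _ => ℓ),
        ((∏ j, Real.sqrt (2 / ℓ) * Real.sin (waveNumber ℓ (k j) * y j) : ℝ) : ℂ) * g y‖ₑ ^ 2 =
      ∑' n : ℕ, w n * ∑' k' : Fin d → ℕ, ‖∫ y' in Icc (0 : Fin d → ℝ) (fun _ => ℓ),
        ((∏ j, Real.sqrt (2 / ℓ) * Real.sin (waveNumber ℓ (k' j) * y' j) : ℝ) : ℂ) *
          G n y'‖ₑ ^ 2 := by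
    rw [← (Fin.insertNthEquiv (fun _ => ℕ) i).tsum_eq]
    simp only [Fin.insertNthEquiv_apply, Fin.insertNth_apply_same]
    rw [ENNReal.tsum_prod']
    congr 1; funext n
    rw [← ENNReal.tsum_mul_left]
    congr 1; funext k'
    rw [integral_Icc_prodSinMode_insertNth_mul hℓ i hg n k']
  rw [hL, hR, hR2]

/-! ### Parseval on the cube `[0,ℓ]^d` (induction on `d`) -/

/-- Dimension zero: the cube `[0,ℓ]^0` is a point of mass one and `S_∅ = 1`. [folklore] -/
theorem tsum_enorm_sq_sinCoef_zero (ℓ : ℝ) (g : (Fin 0 → ℝ) → ℂ) :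
    ∑' k : Fin 0 → ℕ, ‖∫ y in Icc (0 : Fin 0 → ℝ) (fun _ => ℓ),
        ((∏ j, Real.sqrt (2 / ℓ) * Real.sin (waveNumber ℓ (k j) * y j) : ℝ) : ℂ) * g y‖ₑ ^ 2 =
      ∫⁻ y in Icc (0 : Fin 0 → ℝ) (fun _ => ℓ), ‖g y‖ₑ ^ 2 := by
  have hI : (Icc (0 : Fin 0 → ℝ) fun _ => ℓ) = univ := by
    ext y
    simp only [Set.mem_Icc, Pi.le_def, IsEmpty.forall_iff, and_self, Set.mem_univ]
  have hvol : (volume : Measure (Fin 0 → ℝ)) = Measure.dirac default := by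
    rw [volume_pi, Measure.pi_of_empty _ default]
  rw [hI, Measure.restrict_univ, hvol, lintegral_dirac, tsum_fintype, Fintype.sum_unique]
  simp

/-- **Parseval for the Dirichlet product sine modes on the cube `[0,ℓ]^d`** (`ℝ≥0∞` form): for
`ℓ > 0` and continuous `g : ℝ^d → ℂ`,
`∑_{k ∈ ℕ^d} ‖∫_{[0,ℓ]^d} S_k g‖² = ∫_{[0,ℓ]^d} ‖g‖²`, `S_k(y) = ∏ⱼ s_{kⱼ}(yⱼ)` — the product sine
modes are complete in `L²([0,ℓ]^d)` (indices with a zero entry contribute `0`). Induction on `d`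
through the slicing engine with the one-dimensional sine Parseval on each fibre.
[cite: LSSY2005, Ch. 2, after (2.50)] -/
theorem tsum_enorm_sq_sinCoef (hℓ : 0 < ℓ) :
    ∀ (d : ℕ) {g : (Fin d → ℝ) → ℂ}, Continuous g →
      ∑' k : Fin d → ℕ, ‖∫ y in Icc (0 : Fin d → ℝ) (fun _ => ℓ),
          ((∏ j, Real.sqrt (2 / ℓ) * Real.sin (waveNumber ℓ (k j) * y j) : ℝ) : ℂ) * g y‖ₑ ^ 2 =
        ∫⁻ y in Icc (0 : Fin d → ℝ) (fun _ => ℓ), ‖g y‖ₑ ^ 2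
  | 0, g, _ => tsum_enorm_sq_sinCoef_zero ℓ g
  | d + 1, g, hg => by
    have key := tsum_mul_enorm_sq_sinCoef_eq_of_fibre hℓ
      (fun hg' => tsum_enorm_sq_sinCoef hℓ d hg') 0 hg (fun _ => 1)
      (hg.measurable.enorm.pow_const 2) (fun y' => by
        have hc : Continuous fun t : ℝ => g (Fin.insertNth 0 t y') :=
          hg.comp (Continuous.finInsertNth 0 continuous_id continuous_const)
        simpa only [one_mul] using tsum_enorm_sq_integral_sinMode_mul hℓ hc)
    simpa only [one_mul] using key

/-! ### The Dirichlet form on the cube is diagonal in the product sine modes -/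

/-- **The form identity in one coordinate direction**: for `g ∈ C¹(ℝ^{d+1})` vanishing on the two
faces `{yᵢ = 0}`, `{yᵢ = ℓ}` of the cube, `ℓ > 0`:
`∑_k (kᵢπ/ℓ)² ‖∫_{[0,ℓ]^{d+1}} S_k g‖² = ∫_{[0,ℓ]^{d+1}} ‖∂ᵢ g‖²` — the slicing engine with the
one-dimensional Dirichlet form identity on each fibre. [cite: LSSY2005, Ch. 2, after (2.50)] -/
theorem tsum_waveNumber_sq_mul_enorm_sq_sinCoef (hℓ : 0 < ℓ) (i : Fin (d + 1))
    {g : (Fin (d + 1) → ℝ) → ℂ} (hg : ContDiff ℝ 1 g)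
    (hg0 : ∀ y : Fin (d + 1) → ℝ, y i = 0 → g y = 0) (hgℓ : ∀ y : Fin (d + 1) → ℝ, y i = ℓ → g y = 0) :
    ∑' k : Fin (d + 1) → ℕ, ENNReal.ofReal (waveNumber ℓ (k i) ^ 2) *
        ‖∫ y in Icc (0 : Fin (d + 1) → ℝ) (fun _ => ℓ),
          ((∏ j, Real.sqrt (2 / ℓ) * Real.sin (waveNumber ℓ (k j) * y j) : ℝ) : ℂ) * g y‖ₑ ^ 2 =
      ∫⁻ y in Icc (0 : Fin (d + 1) → ℝ) (fun _ => ℓ), ‖fderiv ℝ g y (Pi.single i 1)‖ₑ ^ 2 := by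
  have hgd : Differentiable ℝ g := hg.differentiable one_ne_zero
  have hdc : Continuous fun y => fderiv ℝ g y (Pi.single i 1) :=
    (hg.continuous_fderiv one_ne_zero).clm_apply continuous_const
  refine tsum_mul_enorm_sq_sinCoef_eq_of_fibre hℓ (fun hg' => tsum_enorm_sq_sinCoef hℓ d hg') i
    hg.continuous (fun n => ENNReal.ofReal (waveNumber ℓ n ^ 2))
    (hdc.measurable.enorm.pow_const 2) fun y' => ?_
  have hc : Continuous fun t : ℝ => fderiv ℝ g (i.insertNth t y') (Pi.single i 1) :=
    hdc.comp (Continuous.finInsertNth i continuous_id continuous_const)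
  exact tsum_waveNumber_sq_mul_enorm_sq_integral_sinMode_mul hℓ
    (fun t _ => hasDerivAt_comp_insertNth i hgd y' t) hc
    (hg0 _ (by simp)) (hgℓ _ (by simp))

/-- **The Dirichlet form `∫|∇g|²` on the cube is diagonal in the product sine modes, with
eigenvalues `(π/ℓ)²|k|²** (`ℝ≥0∞` form): for `g ∈ C¹(ℝ^{d+1})` vanishing on every face of the cube
and `ℓ > 0`, `∑_k (∑ᵢ (kᵢπ/ℓ)²) ‖∫_{[0,ℓ]^{d+1}} S_k g‖² = ∫_{[0,ℓ]^{d+1}} ∑ᵢ ‖∂ᵢg‖²`.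
[cite: LSSY2005, Ch. 2, after (2.50)] -/
theorem tsum_sum_waveNumber_sq_mul_enorm_sq_sinCoef (hℓ : 0 < ℓ) {g : (Fin (d + 1) → ℝ) → ℂ}
    (hg : ContDiff ℝ 1 g)
    (hbd : ∀ (y : Fin (d + 1) → ℝ) (i : Fin (d + 1)), y i = 0 ∨ y i = ℓ → g y = 0) :
    ∑' k : Fin (d + 1) → ℕ, ENNReal.ofReal (∑ i, waveNumber ℓ (k i) ^ 2) *
        ‖∫ y in Icc (0 : Fin (d + 1) → ℝ) (fun _ => ℓ),
          ((∏ j, Real.sqrt (2 / ℓ) * Real.sin (waveNumber ℓ (k j) * y j) : ℝ) : ℂ) * g y‖ₑ ^ 2 =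
      ∫⁻ y in Icc (0 : Fin (d + 1) → ℝ) (fun _ => ℓ),
        ∑ i, ‖fderiv ℝ g y (Pi.single i 1)‖ₑ ^ 2 := by
  have hdc : ∀ i : Fin (d + 1), Continuous fun y => fderiv ℝ g y (Pi.single i 1) := fun i =>
    (hg.continuous_fderiv one_ne_zero).clm_apply continuous_const
  rw [lintegral_finsetSum _ fun i _ => (hdc i).measurable.enorm.pow_const 2]
  simp_rw [ENNReal.ofReal_sum_of_nonneg (fun i _ => sq_nonneg _), Finset.sum_mul]
  rw [Summable.tsum_finsetSum fun i _ => ENNReal.summable]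
  exact Finset.sum_congr rfl fun i _ => tsum_waveNumber_sq_mul_enorm_sq_sinCoef hℓ i hg
    (fun y hy => hbd y i (Or.inl hy)) (fun y hy => hbd y i (Or.inr hy))

end Literature.MathematicalPhysics.QuantumManyBody.DirichletBox

end
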